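import Summits.QuantumFields.YangMills.Theorems.F4SubCurvatureDoorChannelSymmetry
import Literature.LinearAlgebra.UnisolventPoints
import Mathlib
import HarnessLib

/-!
# Route `F4SubCurvatureDoor`, crux ⟨stmt-QuantumFields-23125⟩ `RationalToGeneral`: LINE g18-A v5 — CSF build-plan brick C2(iii)
# «channel coefficients are fixed linear combinations of point values of the kernel» (def-free)

Owner ym-idea-3 g18's build plan for `stub_channelShellForm` (§4 C2(iii), «NO ∫_{S³}, no Haar averaging»): once a kernel is expanded in a
LINEARLY INDEPENDENT family of harmonic homogeneous polynomials, `K(x) = Σ_j β_j(‖x‖)·B_j(x)` off the origin (`deg B_j = e_j`), choose unisolvent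
points `ω_1, …, ω_n` on the unit sphere (✓`F4SubCurvatureDoorChannelSymmetry.exists_sphere_points_det_ne_zero`, from
✓`Literature.LinearAlgebra.UnisolventPoints`); then with `M = [B_j(ω_i)]`:

* ★ `channelCoeff_eq_sum_pointValues` — `β_j(r)·r^{e_j} = Σ_i (M⁻¹)_{ji} K(r ω_i)` for every `r > 0`;
* `continuousOn_channelCoeff` — if `K` is continuous off the origin, every `r ↦ β_j(r) r^{e_j}` is continuous on `(0,∞)`;
* `abs_channelCoeff_le` — `|β_j(r)| r^{e_j} ≤ (Σ_i |(M⁻¹)_{ji}|) · max-type bound by the point values `|K(r ω_i)|` (stated with any common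
  bound `g(r)`), which turns the sub-curvature budget `‖x‖⁸K(x) → 0` into `r^{e_j+8} β_j(r) → 0`.

THEOREMS ONLY; Mathlib + tree; no `sorry`.  HONEST FRAMING: a bookkeeping brick of an OPEN XL stub (`ChannelShellForm`); nothing about T1″, C3,
crux 23125 / 23035, rung R2d or the summit; the Yang–Mills mass gap is NOT proved.  Seat `ym-line-frs-p2` g13 (free hands),
`--supports stmt-QuantumFields-23125`. [cite: Cheney1982, Ch. 3 Problem 23]
-/

set_option autoImplicit false

noncomputable section

namespace Summit.QuantumFields.YangMills.Theorems.F4SubCurvatureDoorChannelExtraction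

open MvPolynomial Matrix
open scoped BigOperators
open Literature.LinearAlgebra (evalMatrix evalMatrix_apply coeff_eq_sum_inv_mul_eval)
open Summit.QuantumFields.YangMills.Theorems.F4SubCurvatureDoorHarmonicSphere (eval_smul_of_isHomogeneous)

/-- Points of the unit sphere scaled by `r`: the coordinates of `r • ω`. [cite: Cheney1982, Ch. 3 Problem 23] -/
theorem coe_smul_sphere (r : ℝ) (ω : Metric.sphere (0 : EuclideanSpace ℝ (Fin 4)) 1) :
    (fun i => ((r • (ω : EuclideanSpace ℝ (Fin 4))) : EuclideanSpace ℝ (Fin 4)) i) =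
      fun i => r * (ω : EuclideanSpace ℝ (Fin 4)) i := by
  funext i
  simp

/-- ★ **Channel coefficients from point values**: if `K(x) = Σ_j β_j(‖x‖) B_j(x)` for `x ≠ 0` with `B_j` homogeneous of degree `e_j`, and
`ω` are points of the unit sphere with invertible evaluation matrix `M = [B_j(ω_i)]`, then for every `r > 0` and every `j`,
`β_j(r) r^{e_j} = Σ_i (M⁻¹)_{ji} K(r ω_i)`. [cite: Cheney1982, Ch. 3 Problem 23] -/
theorem channelCoeff_eq_sum_pointValues {n : ℕ} (B : Fin n → MvPolynomial (Fin 4) ℝ) (e : Fin n → ℕ)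
    (hB : ∀ j, (B j).IsHomogeneous (e j)) (K : EuclideanSpace ℝ (Fin 4) → ℝ) (β : Fin n → ℝ → ℝ)
    (hK : ∀ x : EuclideanSpace ℝ (Fin 4), x ≠ 0 → K x = ∑ j, β j ‖x‖ * eval (fun i => x i) (B j))
    (ω : Fin n → Metric.sphere (0 : EuclideanSpace ℝ (Fin 4)) 1)
    (hω : (evalMatrix (fun j (w : Metric.sphere (0 : EuclideanSpace ℝ (Fin 4)) 1) =>
      eval (fun i => (w : EuclideanSpace ℝ (Fin 4)) i) (B j)) ω).det ≠ 0)
    {r : ℝ} (hr : 0 < r) (j : Fin n) :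
    β j r * r ^ (e j) =
      ∑ i, (evalMatrix (fun j (w : Metric.sphere (0 : EuclideanSpace ℝ (Fin 4)) 1) =>
          eval (fun l => (w : EuclideanSpace ℝ (Fin 4)) l) (B j)) ω)⁻¹ j i *
        K (r • (ω i : EuclideanSpace ℝ (Fin 4))) := by
  have h := coeff_eq_sum_inv_mul_eval hω (fun j => β j r * r ^ (e j)) j
  rw [h]
  refine Finset.sum_congr rfl fun i _ => ?_
  congr 1
  -- the value `K(r ω_i)` is the combination of the `B_j(ω_i)` with coefficients `β_j(r) r^{e_j}`
  have hne : r • (ω i : EuclideanSpace ℝ (Fin 4)) ≠ 0 := by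
    have hω1 : ‖(ω i : EuclideanSpace ℝ (Fin 4))‖ = 1 := by simp
    intro h0
    have := congrArg (fun v : EuclideanSpace ℝ (Fin 4) => ‖v‖) h0
    simp only [norm_smul, Real.norm_eq_abs, hω1, mul_one, norm_zero] at this
    exact hr.ne' (abs_eq_zero.1 this)
  have hnorm : ‖r • (ω i : EuclideanSpace ℝ (Fin 4))‖ = r := by
    have hω1 : ‖(ω i : EuclideanSpace ℝ (Fin 4))‖ = 1 := by simp
    rw [norm_smul, Real.norm_eq_abs, abs_of_pos hr, hω1, mul_one]
  rw [hK _ hne, hnorm]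
  refine Finset.sum_congr rfl fun k _ => ?_
  rw [coe_smul_sphere, eval_smul_of_isHomogeneous (hB k) r]
  ring

/-- **Continuity transfer**: if `K` is continuous off the origin then every `r ↦ β_j(r) r^{e_j}` is continuous on `(0,∞)`.
[cite: Cheney1982, Ch. 3 Problem 23] -/
theorem continuousOn_channelCoeff {n : ℕ} (B : Fin n → MvPolynomial (Fin 4) ℝ) (e : Fin n → ℕ)
    (hB : ∀ j, (B j).IsHomogeneous (e j)) (K : EuclideanSpace ℝ (Fin 4) → ℝ) (hKc : ContinuousOn K {x | x ≠ 0})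
    (β : Fin n → ℝ → ℝ)
    (hK : ∀ x : EuclideanSpace ℝ (Fin 4), x ≠ 0 → K x = ∑ j, β j ‖x‖ * eval (fun i => x i) (B j))
    (ω : Fin n → Metric.sphere (0 : EuclideanSpace ℝ (Fin 4)) 1)
    (hω : (evalMatrix (fun j (w : Metric.sphere (0 : EuclideanSpace ℝ (Fin 4)) 1) =>
      eval (fun i => (w : EuclideanSpace ℝ (Fin 4)) i) (B j)) ω).det ≠ 0) (j : Fin n) :
    ContinuousOn (fun r => β j r * r ^ (e j)) (Set.Ioi 0) := by
  have hpt : ∀ i, ContinuousOn (fun r : ℝ => K (r • (ω i : EuclideanSpace ℝ (Fin 4)))) (Set.Ioi 0) := by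
    intro i
    have hω1 : ‖(ω i : EuclideanSpace ℝ (Fin 4))‖ = 1 := by simp
    refine hKc.comp (continuous_id.smul continuous_const).continuousOn fun r hr => ?_
    intro h0
    have := congrArg (fun v : EuclideanSpace ℝ (Fin 4) => ‖v‖) h0
    simp only [norm_smul, Real.norm_eq_abs, hω1, mul_one, norm_zero] at this
    exact (ne_of_gt (show (0:ℝ) < r from hr)) (abs_eq_zero.1 this)
  have hsum : ContinuousOn (fun r : ℝ => ∑ i, (evalMatrix (fun j (w : Metric.sphere (0 : EuclideanSpace ℝ (Fin 4)) 1) =>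
      eval (fun l => (w : EuclideanSpace ℝ (Fin 4)) l) (B j)) ω)⁻¹ j i * K (r • (ω i : EuclideanSpace ℝ (Fin 4)))) (Set.Ioi 0) :=
    continuousOn_finsetSum _ fun i _ => continuousOn_const.mul (hpt i)
  refine hsum.congr fun r hr => ?_
  exact channelCoeff_eq_sum_pointValues B e hB K β hK ω hω hr j

/-- **Bound transfer**: a common bound `|K(r ω_i)| ≤ g(r)` at the chosen points gives `|β_j(r)| r^{e_j} ≤ (Σ_i |(M⁻¹)_{ji}|)·g(r)`;
with the sub-curvature budget this is the decay of the channel coefficients at `0⁺`. [cite: Cheney1982, Ch. 3 Problem 23] -/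
theorem abs_channelCoeff_le {n : ℕ} (B : Fin n → MvPolynomial (Fin 4) ℝ) (e : Fin n → ℕ)
    (hB : ∀ j, (B j).IsHomogeneous (e j)) (K : EuclideanSpace ℝ (Fin 4) → ℝ) (β : Fin n → ℝ → ℝ)
    (hK : ∀ x : EuclideanSpace ℝ (Fin 4), x ≠ 0 → K x = ∑ j, β j ‖x‖ * eval (fun i => x i) (B j))
    (ω : Fin n → Metric.sphere (0 : EuclideanSpace ℝ (Fin 4)) 1)
    (hω : (evalMatrix (fun j (w : Metric.sphere (0 : EuclideanSpace ℝ (Fin 4)) 1) =>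
      eval (fun i => (w : EuclideanSpace ℝ (Fin 4)) i) (B j)) ω).det ≠ 0)
    {r : ℝ} (hr : 0 < r) {g : ℝ} (hg : ∀ i, |K (r • (ω i : EuclideanSpace ℝ (Fin 4)))| ≤ g) (j : Fin n) :
    |β j r| * r ^ (e j) ≤
      (∑ i, |(evalMatrix (fun j (w : Metric.sphere (0 : EuclideanSpace ℝ (Fin 4)) 1) =>
          eval (fun l => (w : EuclideanSpace ℝ (Fin 4)) l) (B j)) ω)⁻¹ j i|) * g := by
  have h := channelCoeff_eq_sum_pointValues B e hB K β hK ω hω hr j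
  have habs : |β j r| * r ^ (e j) = |β j r * r ^ (e j)| := by
    rw [abs_mul, abs_of_pos (pow_pos hr _)]
  rw [habs, h, Finset.sum_mul]
  refine (Finset.abs_sum_le_sum_abs _ _).trans (Finset.sum_le_sum fun i _ => ?_)
  rw [abs_mul]
  exact mul_le_mul_of_nonneg_left (hg i) (abs_nonneg _)

/-- **Budget transfer** (last clause of C2(iii)): the sub-curvature budget `‖x‖⁸ K(x) → 0` at the origin forces
`r^{e_j + 8} β_j(r) → 0` as `r → 0⁺` for every channel coefficient of an independent harmonic expansion. [cite: Cheney1982, Ch. 3 Problem 23] -/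
theorem tendsto_channelCoeff_budget {n : ℕ} (B : Fin n → MvPolynomial (Fin 4) ℝ) (e : Fin n → ℕ)
    (hB : ∀ j, (B j).IsHomogeneous (e j)) (K : EuclideanSpace ℝ (Fin 4) → ℝ)
    (hbud : Filter.Tendsto (fun x : EuclideanSpace ℝ (Fin 4) => ‖x‖ ^ 8 * K x) (nhdsWithin 0 {x | x ≠ 0}) (nhds 0))
    (β : Fin n → ℝ → ℝ)
    (hK : ∀ x : EuclideanSpace ℝ (Fin 4), x ≠ 0 → K x = ∑ j, β j ‖x‖ * eval (fun i => x i) (B j))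
    (ω : Fin n → Metric.sphere (0 : EuclideanSpace ℝ (Fin 4)) 1)
    (hω : (evalMatrix (fun j (w : Metric.sphere (0 : EuclideanSpace ℝ (Fin 4)) 1) =>
      eval (fun i => (w : EuclideanSpace ℝ (Fin 4)) i) (B j)) ω).det ≠ 0) (j : Fin n) :
    Filter.Tendsto (fun r : ℝ => r ^ (e j + 8) * β j r) (nhdsWithin 0 (Set.Ioi 0)) (nhds 0) := by
  -- `r ↦ r • ω_i` tends to `0` within `{x ≠ 0}` as `r → 0⁺`
  have hω1 : ∀ i, ‖(ω i : EuclideanSpace ℝ (Fin 4))‖ = 1 := fun i => by simp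
  have hpath : ∀ i, Filter.Tendsto (fun r : ℝ => r • (ω i : EuclideanSpace ℝ (Fin 4))) (nhdsWithin 0 (Set.Ioi 0))
      (nhdsWithin 0 {x | x ≠ 0}) := by
    intro i
    refine tendsto_nhdsWithin_iff.2 ⟨?_, ?_⟩
    · have h : Filter.Tendsto (fun r : ℝ => r • (ω i : EuclideanSpace ℝ (Fin 4))) (nhds 0) (nhds ((0:ℝ) • (ω i : EuclideanSpace ℝ (Fin 4)))) :=
        (continuous_id.smul continuous_const).tendsto 0
      rw [zero_smul] at h
      exact h.mono_left nhdsWithin_le_nhds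
    · refine eventually_nhdsWithin_of_forall fun r (hr : 0 < r) => ?_
      intro h0
      have := congrArg (fun v : EuclideanSpace ℝ (Fin 4) => ‖v‖) h0
      simp only [norm_smul, Real.norm_eq_abs, hω1, mul_one, norm_zero] at this
      exact hr.ne' (abs_eq_zero.1 this)
  -- each point value term tends to `0`
  have hterm : ∀ i, Filter.Tendsto (fun r : ℝ => r ^ 8 * K (r • (ω i : EuclideanSpace ℝ (Fin 4))))
      (nhdsWithin 0 (Set.Ioi 0)) (nhds 0) := by
    intro i
    have h := hbud.comp (hpath i)
    refine (h.congr' ?_)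
    refine eventually_nhdsWithin_of_forall fun r (hr : 0 < r) => ?_
    simp only [Function.comp_apply, norm_smul, Real.norm_eq_abs, abs_of_pos hr, hω1, mul_one]
  set A := (evalMatrix (fun j (w : Metric.sphere (0 : EuclideanSpace ℝ (Fin 4)) 1) =>
      eval (fun l => (w : EuclideanSpace ℝ (Fin 4)) l) (B j)) ω)⁻¹ with hA
  have hsum : Filter.Tendsto (fun r : ℝ => ∑ i, A j i * (r ^ 8 * K (r • (ω i : EuclideanSpace ℝ (Fin 4)))))
      (nhdsWithin 0 (Set.Ioi 0)) (nhds (∑ i : Fin n, A j i * 0)) :=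
    tendsto_finsetSum _ fun i _ => (hterm i).const_mul (A j i)
  simp only [mul_zero, Finset.sum_const_zero] at hsum
  refine hsum.congr' ?_
  refine eventually_nhdsWithin_of_forall fun r (hr : 0 < r) => ?_
  have h := channelCoeff_eq_sum_pointValues B e hB K β hK ω hω hr j
  show ∑ i, A j i * (r ^ 8 * K (r • (ω i : EuclideanSpace ℝ (Fin 4)))) = r ^ (e j + 8) * β j r
  calc ∑ i, A j i * (r ^ 8 * K (r • (ω i : EuclideanSpace ℝ (Fin 4))))
      = r ^ 8 * ∑ i, A j i * K (r • (ω i : EuclideanSpace ℝ (Fin 4))) := by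
        rw [Finset.mul_sum]
        exact Finset.sum_congr rfl fun i _ => by ring
    _ = r ^ 8 * (β j r * r ^ (e j)) := by rw [h]
    _ = r ^ (e j + 8) * β j r := by ring

end Summit.QuantumFields.YangMills.Theorems.F4SubCurvatureDoorChannelExtraction

end
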